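import Literature.Computability.QuantumComplexity.GenericStabilizerRank
import Literature.Computability.QuantumComplexity.StabilizerSimulationProofs
import HarnessLib

/-!
# The generic stabilizer rank: `χ_n ≥ n + 1` (Lovitz–Steffan 2022, §5) — discharged fact

Proof of the named fact `LovitzSteffan2022_genericStabilizerRank_ge` of
`Literature.Computability.QuantumComplexity.GenericStabilizerRank` (kept in a sibling file so
that the statement file keeps its light imports):

B. Lovitz, V. Steffan, *New techniques for bounding stabilizer rank*, Quantum 6 (2022) 692 =
arXiv:2110.07781, §5, remark after Proposition 5.3: "Since `dim(S^n(ℂ²)) = n+1`, it follows from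
Proposition 5.3 that `χ_n ≥ n+1`."

## Proof architecture

The printed one-liner rests on Proposition 5.3 (a single set of `χ_n` stabilizer states spans
`S^n(ℂ²)`), itself a consequence of Fact 5.1 (genericity, via the irreducibility of the Veronese
curve `ν_n(P¹)` and the finiteness of `Stab_n`). We follow instead the counting argument printed
in the proof of Proposition 5.6 of the same section, which needs no algebraic geometry and only
the COUNTABILITY of `Stab_n` (immediate from the tree's operational definition of stabilizer
states as the Clifford-monoid orbit of `|0ⁿ⟩`; finiteness would require the stabilizer
formalism, which the tree does not have):

* "any set of `n+1` distinct tensors of the form `ψ^{⊗n}` span `S^n(ℂ²)`" (proof of Prop. 5.6,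
  citing Kruskal) — here for the affine line `ψ_t = |0⟩ + t|1⟩`, `t ∈ ℂ`: the amplitude of
  `ψ_t^{⊗n}` at a basis state of Hamming weight `k` is `t^k` (`tensorPow_apply`,
  `prod_ite_val_lt`), so a vanishing combination of `ψ_{t_0}^{⊗n}, …, ψ_{t_n}^{⊗n}` with distinct
  `t_j` has its coefficient vector killed by the Vandermonde matrix of `t`
  (`Matrix.det_vandermonde_ne_zero_iff`): `linearIndependent_tensorPow_line`;
* hence "any set of [at most `n`] linearly independent stabilizer states can contain at most `n`
  distinct elements of `ν̂_1(P¹)` in their span" (proof of Prop. 5.6): a subspace of dimension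
  `≤ n` contains `ψ_t^{⊗n}` for only finitely many `t` (`finite_setOf_tensorPow_line_mem`);
* `Stab_n` is countable (`countable_stabilizerStates`: the Clifford monoid is the set of products
  of lists of the finitely many gate placements, `Submonoid.exists_list_of_mem_closure`), so the
  set of `t` with `χ(ψ_t^{⊗n}) ≤ n` — covered by the spans of countably many `r`-tuples of
  stabilizer states, `r ≤ n` (`exists_stabilizerDecomposition`) — is countable
  (`countable_setOf_stabilizerRank_tensorPow_line_le`);
* `ℂ` is uncountable (`not_countable_complex`), so some `t` has `χ(ψ_t^{⊗n}) ≥ n + 1`, and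
  `χ_n = sSup {χ(ψ^{⊗n})}` (a set bounded by `2ⁿ`, `stabilizerRank_le_two_pow`) is at least that.

The hypothesis `0 < n` of the printed statement is not used (`χ_0 = 1`).

## Proposition 5.3 (one stabilizer cover of the symmetric subspace) — second discharge

`LovitzSteffan2022_prop53_holds` discharges `LovitzSteffan2022_prop53`: for every `n ≥ 1` there
are `χ_n` stabilizer states `σ_1, …, σ_{χ_n}` whose span contains every wire-permutation-invariant
amplitude function, `S^n(ℂ²) ⊆ span{σ_1, …, σ_{χ_n}}` (Proposition 5.3, p. 13 of the held text).
Printed proof: "Let `r = χ_n`, so `Σ_r(Stab_n) ⊇ ν_n(P¹)`. Since `ν_n(P¹)` is irreducible, and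
`Σ_r(Stab_n)` is reducible into a finite union of projective `(r−1)`-dimensional linear
subspaces, one of these subspaces must contain `ν_n(P¹)`. To complete the proof, recall that the
affine cone over `span(ν_n(P¹))` is `S^n(ℂ²)`." Formalised in the same elementary clothing as
above (countable instead of finite `Stab_n`, the affine line `ψ_t = |0⟩ + t|1⟩` for `ν_n(P¹)`):

* `stabilizerRank_tensorPow_le_genericStabilizerRank`, `exists_stabilizerCover_of_rank_le`:
  every `ψ_t^{⊗n}` lies in the span of SOME family `S : Fin χ_n → Stab_n` (a minimal
  decomposition padded with copies of `|0ⁿ⟩`) — "`Σ_r(Stab_n) ⊇ ν_n(P¹)`";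
* `tensorPow_line_apply`: `ψ_t^{⊗n}(x) = t^{|x|}` (`|x|` = Hamming weight);
  `exists_perm_of_weight_eq`, `apply_eq_of_perm_invariant`: a wire-permutation-invariant `f`
  is a function of the Hamming weight (`Equiv.ofFiberEquiv`), i.e. `S^n(ℂ²)` is spanned by the
  weight indicators `∑_{|x|=k} e_x` (the basis named in the proof of Proposition 5.4);
* `mem_of_perm_invariant_of_line_mem` — the irreducibility step together with "the affine cone
  over `span(ν_n(P¹))` is `S^n(ℂ²)`": a subspace containing `n + 1` DISTINCT points
  `ψ_{t_0}^{⊗n}, …, ψ_{t_n}^{⊗n}` contains every symmetric `f` (the combinations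
  `∑_i (M⁻¹)_{ki} ψ_{t_i}^{⊗n}`, `M` the Vandermonde matrix of `t`, are the weight indicators;
  `Matrix.det_vandermonde_ne_zero_iff`, `Matrix.nonsing_inv_mul`);
* `LovitzSteffan2022_prop53_holds`: `ℂ = ⋃_S {t : ψ_t^{⊗n} ∈ span S}` over the countably many
  families `S` (`countable_stabilizerStates`); `ℂ` is uncountable (`not_countable_complex`), so
  one `span S` — one of the linear spaces making up `Σ_{χ_n}(Stab_n)` — contains infinitely many,
  in particular `n + 1` distinct, points of the curve (`Set.Infinite.natEmbedding`), hence all of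
  `S^n(ℂ²)`.

## Proposition 5.5 (cheap distinct angles bound `χ_n`) — third discharge

`LovitzSteffan2022_prop55_holds` discharges `LovitzSteffan2022_prop55`: "Let `r` be a positive
integer. If there exists a set of `n+1` distinct qubit states `{[ψ_1],…,[ψ_{n+1}]} ⊆ P¹` with
`χ([ψ_i^{⊗n}]) ≤ r` for all `i ∈ [n+1]`, then `χ_n ≤ r(n+1)`" (Proposition 5.5, p. 14 of the held
text). Printed proof: "by taking the span of the union of all stabilizer states appearing in the
decompositions of each `[ψ_i^{⊗n}]`, we have `{[ψ_1^{⊗n}],…,[ψ_{n+1}^{⊗n}]} ⊆ Σ_{r(n+1)}(Stab_n)`.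
The proposition follows from the fact that the affine cone over any set of `n+1` distinct states
of this form spans `S^n(ℂ²)`." Mirrored as:

* `tensorPow_apply_eq_pow_weight`: `ψ^{⊗n}(z) = ψ(1)^{|z|} ψ(0)^{n-|z|}`;
  `det_ne_zero_of_linearIndependent_pair`: distinct `[ψ_i], [ψ_j] ∈ P¹` have
  `ψ_j(1)ψ_i(0) - ψ_i(1)ψ_j(0) ≠ 0`;
* `tensorPow_mem_span_of_pairwise_linearIndependent` — "any `n+1` distinct states of this form
  span": every `ψ^{⊗n}` is a combination of `ψ_0^{⊗n}, …, ψ_n^{⊗n}`, the coefficient vector being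
  a preimage under `vecMul` by the PROJECTIVE Vandermonde matrix `(ψ_i(1)^k ψ_i(0)^{n-k})_{i,k}`
  (`Matrix.projVandermonde`, `Matrix.det_projVandermonde`, `Matrix.vecMul_surjective_iff_isUnit`)
  — the general-position form of `linearIndependent_tensorPow_line` (no affine chart needed);
* `LovitzSteffan2022_prop55_holds`: the union of the `n+1` optimal decompositions
  (`exists_stabilizerDecomposition`, index `Σ i, Fin χ(ψ_i^{⊗n})`, at most `(n+1)r` states)
  spans every `ψ^{⊗n}`, so `χ(ψ^{⊗n}) ≤ r(n+1)` (`stabilizerRank_le_card`) and `χ_n ≤ r(n+1)`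
  (`csSup_le'`). The printed hypotheses `0 < n`, `0 < r` are not used.

## References

* B. Lovitz, V. Steffan, *New techniques for bounding stabilizer rank*, Quantum 6 (2022) 692,
  arXiv:2110.07781: §5, Proposition 5.3 and the remark after it (`χ_n ≥ n+1`), proof of
  Proposition 5.6 (the counting argument followed here).
* (for Proposition 5.3) ibid., proof of Proposition 5.3 (one subspace of `Σ_{χ_n}(Stab_n)`
  contains the Veronese curve), proof of Proposition 5.4 (the weight-indicator basis of
  `S^n(ℂ²)`), proof of Proposition 5.5 ("any `n+1` distinct `ψ_i^{⊗n}` span `S^n(ℂ²)`", the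
  Vandermonde step); J. Harris, *Algebraic Geometry: A First Course*, GTM 133, Springer 1992,
  Example 1.14 (rational normal curves: any `n + 1` points are independent), the source's
  reference [harris2013algebraic] for the algebraic-geometric facts it uses.
* (for Proposition 5.5) ibid., Proposition 5.5 and its proof (p. 14: union of the decompositions;
  "the affine cone over any set of `n+1` distinct states of this form spans `S^n(ℂ²)`", for which
  the source cites K.-C. Ha, S.-H. Kye, J. Phys. A 48 (2015) 045303, and B. Lovitz, F. Petrov,
  *A generalization of Kruskal's theorem on tensor decomposition*, arXiv:2103.15633).
-/

noncomputable section

namespace Literature.Computability.QuantumComplexity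

open _root_.Computability Cryptography Matrix

/-! ### Amplitudes of tensor powers -/

/-- Amplitudes of a tensor power of a single-qubit vector: `ψ^{⊗m}(x) = ∏ᵢ ψ(xᵢ)`. [folklore] -/
theorem tensorPow_apply (ψ : QReg 1 → ℂ) (m : ℕ) (x : QReg m) :
    tensorPow ψ m x = ∏ i : Fin m, ψ (fun _ => x i) := by
  induction m with
  | zero => simp [tensorPow]
  | succ m ih =>
    rw [Fin.prod_univ_castSucc]
    show tensorPow ψ m (fun i => x (Fin.castAdd 1 i)) * ψ (fun j => x (Fin.natAdd m j)) = _
    rw [ih]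
    congr 1
    congr 1
    funext j
    rw [Subsingleton.elim j 0]
    exact congrArg x (Fin.ext (by simp))

/-- `∏_{i < n} [i < k ? t : 1] = t ^ k` for `k ≤ n`. [folklore] -/
theorem prod_ite_val_lt (n k : ℕ) (hk : k ≤ n) (t : ℂ) :
    (∏ i : Fin n, if (i : ℕ) < k then t else 1) = t ^ k := by
  calc (∏ i : Fin n, if (i : ℕ) < k then t else 1)
      = ∏ i ∈ Finset.range n, if i < k then t else 1 :=
        Fin.prod_univ_eq_prod_range (fun i => if i < k then t else 1) n
    _ = t ^ ((Finset.range n).filter (fun i => i < k)).card := by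
        rw [Finset.prod_ite, Finset.prod_const_one, mul_one, Finset.prod_const]
    _ = t ^ k := by
        have : (Finset.range n).filter (fun i => i < k) = Finset.range k := by
          ext i
          simp only [Finset.mem_filter, Finset.mem_range]
          omega
        rw [this, Finset.card_range]

/-- The amplitude of `(|0⟩ + t|1⟩)^{⊗n}` at the basis state `1^k 0^{n-k}` is `t ^ k`. [folklore] -/
theorem tensorPow_line_apply_indicator (n : ℕ) (t : ℂ) (k : ℕ) (hk : k ≤ n) :
    tensorPow (fun y : QReg 1 => if y 0 then t else 1) n (fun i : Fin n => decide ((i : ℕ) < k)) =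
      t ^ k := by
  rw [tensorPow_apply]
  simp only [decide_eq_true_eq]
  exact prod_ite_val_lt n k hk t

/-! ### `n + 1` distinct points of the Veronese curve are linearly independent -/

/-- **Distinct symmetric product states are linearly independent** (the case of the affine line
`ψ_t = |0⟩ + t|1⟩`): if `t : Fin (n+1) → ℂ` is injective then `ψ_{t_0}^{⊗n}, …, ψ_{t_n}^{⊗n}` are
linearly independent — evaluating a vanishing combination at basis states of Hamming weights
`0, …, n` gives `c ᵥ* Vandermonde(t) = 0`. [cite: LovitzSteffan2022, §5, proof of Proposition 5.6
("any set of `n+1` distinct tensors … of the form `ψ^{⊗n}` span `S^n(ℂ²)`")] -/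
theorem linearIndependent_tensorPow_line {n : ℕ} (t : Fin (n + 1) → ℂ) (ht : Function.Injective t) :
    LinearIndependent ℂ (fun j => tensorPow (fun y : QReg 1 => if y 0 then t j else 1) n) := by
  rw [Fintype.linearIndependent_iff]
  intro c hc j
  have hk : ∀ k : Fin (n + 1), ∑ j, c j * t j ^ (k : ℕ) = 0 := by
    intro k
    have h := congrFun hc (fun i : Fin n => decide ((i : ℕ) < (k : ℕ)))
    simp only [Finset.sum_apply, Pi.smul_apply, smul_eq_mul, Pi.zero_apply,
      tensorPow_line_apply_indicator n _ k (Nat.lt_succ_iff.mp k.isLt)] at h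
    exact h
  have hvm : c ᵥ* Matrix.vandermonde t = 0 := by
    funext k
    simpa [Matrix.vecMul, dotProduct, Matrix.vandermonde_apply] using hk k
  have hdet : (Matrix.vandermonde t).det ≠ 0 := Matrix.det_vandermonde_ne_zero_iff.mpr ht
  exact congrFun (Matrix.eq_zero_of_vecMul_eq_zero hdet hvm) j

/-- A subspace of dimension at most `n` contains `ψ_t^{⊗n}` for only finitely many `t`
("any set of [fewer than `n+1`] linearly independent … states can contain at most `n` distinct
elements of `ν̂_1(P¹)` in their span"). [cite: LovitzSteffan2022, §5, proof of Proposition 5.6] -/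
theorem finite_setOf_tensorPow_line_mem {n : ℕ} (W : Submodule ℂ (QReg n → ℂ))
    (hW : Module.finrank ℂ W ≤ n) :
    {t : ℂ | tensorPow (fun y : QReg 1 => if y 0 then t else 1) n ∈ W}.Finite := by
  by_contra hinf
  obtain ⟨s, hs, hcard⟩ := Set.Infinite.exists_subset_card_eq hinf (n + 1)
  let e : Fin (n + 1) → {x // x ∈ s} := fun j => s.equivFin.symm (j.cast hcard.symm)
  have he : Function.Injective e := s.equivFin.symm.injective.comp (Fin.cast_injective _)
  let t : Fin (n + 1) → ℂ := fun j => (e j : ℂ)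
  have ht : Function.Injective t := Subtype.val_injective.comp he
  have hmem : ∀ j, tensorPow (fun y : QReg 1 => if y 0 then t j else 1) n ∈ W :=
    fun j => hs (e j).2
  have hli : LinearIndependent ℂ (fun j => (⟨_, hmem j⟩ : W)) :=
    LinearIndependent.of_comp W.subtype (linearIndependent_tensorPow_line t ht)
  have hcard_le := hli.fintype_card_le_finrank
  rw [Fintype.card_fin] at hcard_le
  omega

/-! ### Stabilizer states form a countable set -/

/-- The Clifford monoid on `n` wires is countable: it consists of the products of lists of the
finitely many placements of `H`, `S`, `CNOT`. [folklore] -/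
theorem countable_cliffordCircuits (n : ℕ) :
    ((cliffordCircuits n : Submonoid (Matrix (QReg n) (QReg n) ℂ)) :
      Set (Matrix (QReg n) (QReg n) ℂ)).Countable := by
  have hgen : (placements clifford n).Countable := by
    refine (Set.countable_range
      (fun p : Σ g : CliffordOp, (Fin (clifford.arity g) ↪ Fin n) =>
        placeGate p.2 (clifford.mat p.1))).mono ?_
    rintro M ⟨g, e, rfl⟩
    exact ⟨⟨g, e⟩, rfl⟩
  haveI : Countable (placements clifford n) := hgen.to_subtype
  refine (Set.countable_range
    (fun l : List (placements clifford n) => (l.map Subtype.val).prod)).mono ?_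
  intro C hC
  obtain ⟨l, hl, rfl⟩ := Submonoid.exists_list_of_mem_closure hC
  obtain ⟨l', rfl⟩ : l ∈ Set.range (List.map (Subtype.val : placements clifford n → _)) := by
    rw [Set.range_list_map_coe]
    exact hl
  exact ⟨l', rfl⟩

/-- **The set of `n`-qubit stabilizer states is countable** (image of the countable Clifford
monoid under `C ↦ C|0ⁿ⟩`; in print `Stab_n` is even finite, `|Stab_n| = 2ⁿ ∏ (2^k + 1)`,
Aaronson–Gottesman 2004, which is not needed). [folklore] -/
theorem countable_stabilizerStates (n : ℕ) : (stabilizerStates n).Countable := by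
  refine ((countable_cliffordCircuits n).image fun C => C *ᵥ zeroState n).mono ?_
  rintro ψ ⟨C, hC, rfl⟩
  exact ⟨C, hC, rfl⟩

/-! ### Counting: sub-generic points of the line are countable -/

/-- The parameters `t ∈ ℂ` with `χ((|0⟩ + t|1⟩)^{⊗n}) ≤ n` form a countable set: each lies in the
fibre of the span of one of countably many `r`-tuples (`r ≤ n`) of stabilizer states, and each
fibre is finite. [cite: LovitzSteffan2022, §5, proof of Proposition 5.6] -/
theorem countable_setOf_stabilizerRank_tensorPow_line_le (n : ℕ) :
    {t : ℂ | stabilizerRank (tensorPow (fun y : QReg 1 => if y 0 then t else 1) n) ≤ n}.Countable := by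
  have hD : ∀ r : ℕ, {φ : Fin r → QReg n → ℂ | ∀ i, φ i ∈ stabilizerStates n}.Countable :=
    fun r => Set.countable_pi fun _ => countable_stabilizerStates n
  refine (Set.countable_iUnion fun r : Fin (n + 1) => (hD r).biUnion fun φ _ =>
    (finite_setOf_tensorPow_line_mem (Submodule.span ℂ (Set.range φ))
      ((finrank_range_le_card φ).trans (by simpa using Nat.lt_succ_iff.mp r.isLt))).countable).mono ?_
  intro t ht
  obtain ⟨c, φ, hφ, hdec⟩ :=
    exists_stabilizerDecomposition (tensorPow (fun y : QReg 1 => if y 0 then t else 1) n)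
  simp only [Set.mem_iUnion, Set.mem_setOf_eq, exists_prop]
  refine ⟨⟨_, Nat.lt_succ_of_le ht⟩, φ, hφ, ?_⟩
  have hsum : ∑ i, c i • φ i ∈ Submodule.span ℂ (Set.range φ) :=
    Submodule.sum_mem _ fun i _ => Submodule.smul_mem _ _ (Submodule.subset_span (Set.mem_range_self i))
  rwa [← hdec] at hsum

/-! ### The discharge -/

/-- **Discharge of `LovitzSteffan2022_genericStabilizerRank_ge`** — "Since `dim(S^n(ℂ²)) = n+1`,
it follows from Proposition 5.3 that `χ_n ≥ n+1`": by the counting above some point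
`ψ_t = |0⟩ + t|1⟩` of the (uncountable) affine line has `χ(ψ_t^{⊗n}) ≥ n + 1`, and `χ_n`, the
supremum of the (bounded, `χ ≤ 2ⁿ`) set of all `χ(ψ^{⊗n})`, is at least that.
[cite: LovitzSteffan2022, §5, remark after Proposition 5.3; proof of Proposition 5.6] -/
theorem LovitzSteffan2022_genericStabilizerRank_ge_holds : LovitzSteffan2022_genericStabilizerRank_ge := by
  intro n _
  obtain ⟨t, ht⟩ : ∃ t : ℂ,
      ¬ stabilizerRank (tensorPow (fun y : QReg 1 => if y 0 then t else 1) n) ≤ n := by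
    by_contra h
    push Not at h
    refine not_countable_complex ?_
    have huniv : (Set.univ : Set ℂ) =
        {t : ℂ | stabilizerRank (tensorPow (fun y : QReg 1 => if y 0 then t else 1) n) ≤ n} :=
      (Set.eq_univ_of_forall h).symm
    rw [huniv]
    exact countable_setOf_stabilizerRank_tensorPow_line_le n
  have hbdd : BddAbove (Set.range fun ψ : QReg 1 → ℂ => stabilizerRank (tensorPow ψ n)) :=
    ⟨2 ^ n, by
      rintro _ ⟨ψ, rfl⟩
      exact stabilizerRank_le_two_pow _⟩
  calc n + 1 ≤ stabilizerRank (tensorPow (fun y : QReg 1 => if y 0 then t else 1) n) :=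
        Nat.lt_of_not_le ht
    _ ≤ genericStabilizerRank n := le_csSup hbdd ⟨_, rfl⟩

/-! ## Proposition 5.3: one stabilizer cover of the symmetric subspace -/

/-! ### `χ(ψ^{⊗n}) ≤ χ_n` and stabilizer covers -/

/-- The set `{χ(ψ^{⊗n}) : ψ}` whose supremum is `χ_n` is bounded by `2ⁿ`. [folklore] -/
theorem bddAbove_range_stabilizerRank_tensorPow (n : ℕ) :
    BddAbove (Set.range fun ψ : QReg 1 → ℂ => stabilizerRank (tensorPow ψ n)) := by
  refine ⟨2 ^ n, ?_⟩
  rintro _ ⟨ψ, rfl⟩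
  exact stabilizerRank_le_two_pow _

/-- `χ(ψ^{⊗n}) ≤ χ_n` for every single-qubit vector `ψ` (the `max` defining `χ_n` is a supremum
over a bounded set). [cite: LovitzSteffan2022, §5 (definition of χ_n)] -/
theorem stabilizerRank_tensorPow_le_genericStabilizerRank (ψ : QReg 1 → ℂ) (n : ℕ) :
    stabilizerRank (tensorPow ψ n) ≤ genericStabilizerRank n :=
  le_csSup (bddAbove_range_stabilizerRank_tensorPow n) ⟨ψ, rfl⟩

/-- **Padding a stabilizer decomposition**: if `χ(ψ) ≤ r` then `ψ` lies in the span of a family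
of exactly `r` stabilizer states (a minimal decomposition, padded with copies of `|0ⁿ⟩`); in the
source's language, `[ψ] ∈ Σ_r(Stab_n)`. [folklore] -/
theorem exists_stabilizerCover_of_rank_le {N r : ℕ} (ψ : QReg N → ℂ)
    (hr : stabilizerRank ψ ≤ r) :
    ∃ σ : Fin r → QReg N → ℂ,
      (∀ i, σ i ∈ stabilizerStates N) ∧ ψ ∈ Submodule.span ℂ (Set.range σ) := by
  obtain ⟨c, φ, hφ, hψ⟩ := exists_stabilizerDecomposition ψ
  refine ⟨fun i => if h : (i : ℕ) < stabilizerRank ψ then φ ⟨i, h⟩ else zeroState N, ?_, ?_⟩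
  · intro i
    dsimp only
    split_ifs with h
    · exact hφ _
    · exact zeroState_mem_stabilizerStates N
  · have key : (∑ i, c i • φ i) ∈ Submodule.span ℂ (Set.range fun i : Fin r =>
        if h : (i : ℕ) < stabilizerRank ψ then φ ⟨i, h⟩ else zeroState N) := by
      refine Submodule.sum_mem _ fun i _ => Submodule.smul_mem _ _ (Submodule.subset_span ?_)
      refine ⟨Fin.castLE hr i, ?_⟩
      have hi : ((Fin.castLE hr i : Fin r) : ℕ) < stabilizerRank ψ := by simp
      dsimp only
      rw [dif_pos hi]
      exact congrArg φ (Fin.ext (by simp))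
    rwa [← hψ] at key

/-! ### Amplitudes of the curve and the weight-indicator description of `S^n(ℂ²)` -/

/-- Amplitudes of the curve point `ψ_t^{⊗n} = (|0⟩ + t|1⟩)^{⊗n}` at an arbitrary basis state:
`ψ_t^{⊗n}(x) = t^{|x|}` with `|x|` the Hamming weight of `x`.
[cite: LovitzSteffan2022, §5 (proof of Fact 5.1: the Veronese embedding ν_n)] -/
theorem tensorPow_line_apply (t : ℂ) (n : ℕ) (x : QReg n) :
    tensorPow (fun y : QReg 1 => if y 0 then t else 1) n x =
      t ^ (Finset.univ.filter fun i => x i = true).card := by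
  rw [tensorPow_apply]
  simp only
  rw [Finset.prod_ite, Finset.prod_const, Finset.prod_const_one, mul_one]

/-- Two Boolean strings of the same Hamming weight differ by a permutation of the wires.
[folklore] -/
theorem exists_perm_of_weight_eq {n : ℕ} (x y : QReg n)
    (h : (Finset.univ.filter fun i => x i = true).card =
      (Finset.univ.filter fun i => y i = true).card) :
    ∃ π : Equiv.Perm (Fin n), y = x ∘ π := by
  classical
  have hfalse : ∀ z : QReg n,
      Fintype.card {i // z i = false} = n - (Finset.univ.filter fun i => z i = true).card := by
    intro z
    rw [Fintype.card_subtype]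
    have := Finset.card_filter_add_card_filter_not (s := (Finset.univ : Finset (Fin n)))
      (fun i => z i = true)
    simp only [Finset.card_univ, Fintype.card_fin, Bool.not_eq_true] at this
    omega
  have hfib : ∀ b : Bool, Fintype.card {i // y i = b} = Fintype.card {i // x i = b} := by
    rintro (_ | _)
    · rw [hfalse, hfalse, h]
    · rw [Fintype.card_subtype, Fintype.card_subtype, h]
  refine ⟨Equiv.ofFiberEquiv (f := y) (g := x) fun b => Fintype.equivOfCardEq (hfib b), ?_⟩
  funext i
  exact (Equiv.ofFiberEquiv_map (f := y) (g := x) (fun b => Fintype.equivOfCardEq (hfib b)) i).symm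

/-- A wire-permutation-invariant amplitude function takes equal values on strings of equal
Hamming weight (so `S^n(ℂ²)` is spanned by the weight indicators `∑_{|x|=k} e_x`).
[cite: LovitzSteffan2022, §5 (proof of Proposition 5.4: the basis of S^n(ℂ²))] -/
theorem apply_eq_of_perm_invariant {n : ℕ} (f : QReg n → ℂ)
    (hf : ∀ (π : Equiv.Perm (Fin n)) (x : QReg n), f (x ∘ π) = f x) (x y : QReg n)
    (h : (Finset.univ.filter fun i => x i = true).card =
      (Finset.univ.filter fun i => y i = true).card) :
    f x = f y := by
  obtain ⟨π, rfl⟩ := exists_perm_of_weight_eq x y h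
  exact (hf π x).symm

/-! ### `n + 1` distinct points of the curve span the symmetric subspace -/

/-- **The span of `n + 1` distinct curve points contains `S^n(ℂ²)`.** If a subspace `V` contains
`ψ_{t_0}^{⊗n}, …, ψ_{t_n}^{⊗n}` for pairwise distinct `t_i`, then it contains every
wire-permutation-invariant `f`: the Vandermonde matrix `M = (t_i^k)` is invertible, the
combinations `∑_i (M⁻¹)_{ki} ψ_{t_i}^{⊗n} ∈ V` are exactly the weight indicators, and `f` is a
combination of those. This is the source's "the affine cone over `span(ν_n(P¹))` is `S^n(ℂ²)`"
together with the elementary form of the irreducibility of `ν_n(P¹)` used in the proof of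
Proposition 5.3 (a linear subspace meeting the curve in more than `n` points contains it); the
same Vandermonde argument is printed in the proof of Proposition 5.5.
[cite: LovitzSteffan2022, §5 (proofs of Propositions 5.3 and 5.5)] -/
theorem mem_of_perm_invariant_of_line_mem {n : ℕ} (V : Submodule ℂ (QReg n → ℂ))
    (t : Fin (n + 1) → ℂ) (ht : Function.Injective t)
    (hV : ∀ i, tensorPow (fun y : QReg 1 => if y 0 then t i else 1) n ∈ V)
    (f : QReg n → ℂ) (hf : ∀ (π : Equiv.Perm (Fin n)) (x : QReg n), f (x ∘ π) = f x) :
    f ∈ V := by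
  classical
  -- the Hamming weight, as an index in `Fin (n + 1)`
  have hwt : ∀ x : QReg n, (Finset.univ.filter fun i => x i = true).card < n + 1 := fun x =>
    Nat.lt_succ_of_le (le_trans (Finset.card_filter_le _ _) (by simp))
  let j : QReg n → Fin (n + 1) := fun x => ⟨(Finset.univ.filter fun i => x i = true).card, hwt x⟩
  -- the Vandermonde matrix of the parameters and its inverse
  let M : Matrix (Fin (n + 1)) (Fin (n + 1)) ℂ := Matrix.vandermonde t
  have hM : IsUnit M.det := isUnit_iff_ne_zero.mpr (Matrix.det_vandermonde_ne_zero_iff.mpr ht)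
  have hNM : M⁻¹ * M = 1 := Matrix.nonsing_inv_mul M hM
  -- the weight indicators, as combinations of the curve points
  let E : Fin (n + 1) → QReg n → ℂ := fun k =>
    ∑ i, M⁻¹ k i • tensorPow (fun y : QReg 1 => if y 0 then t i else 1) n
  have hE_mem : ∀ k, E k ∈ V := fun k =>
    Submodule.sum_mem _ fun i _ => Submodule.smul_mem _ _ (hV i)
  have hE_apply : ∀ k x, E k x = if k = j x then 1 else 0 := by
    intro k x
    simp only [E, Finset.sum_apply, Pi.smul_apply, smul_eq_mul, tensorPow_line_apply]
    have hx : ∀ i, t i ^ (Finset.univ.filter fun l => x l = true).card = M i (j x) := fun i => by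
      simp [M, Matrix.vandermonde_apply, j]
    simp_rw [hx]
    rw [← Matrix.mul_apply, hNM, Matrix.one_apply]
  -- the values of `f` on the weight classes
  let F : Fin (n + 1) → ℂ := fun k => if h : ∃ x, j x = k then f h.choose else 0
  have hfE : f = ∑ k, F k • E k := by
    funext x
    simp only [Finset.sum_apply, Pi.smul_apply, smul_eq_mul, hE_apply, mul_ite, mul_one,
      mul_zero]
    rw [Finset.sum_ite_eq' Finset.univ (j x) F, if_pos (Finset.mem_univ _)]
    have hx : ∃ x', j x' = j x := ⟨x, rfl⟩
    simp only [F, dif_pos hx]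
    refine apply_eq_of_perm_invariant f hf x hx.choose ?_
    exact (congrArg Fin.val hx.choose_spec).symm
  rw [hfE]
  exact Submodule.sum_mem _ fun k _ => Submodule.smul_mem _ _ (hE_mem k)

/-! ### The discharge of Proposition 5.3 -/

/-- **Discharge of `LovitzSteffan2022_prop53`** (Lovitz–Steffan 2022, Proposition 5.3: "For any
positive integer `n`, there exists a single set of stabilizer states
`{[σ_1],…,[σ_{χ_n}]} ⊆ Stab_n` for which `S^n(ℂ²) ⊆ span{σ_1,…,σ_{χ_n}}`."). Following the
printed proof: every curve point `ψ_t^{⊗n} = (|0⟩ + t|1⟩)^{⊗n}` lies in the span of some family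
`S : Fin χ_n → Stab_n` (`χ(ψ_t^{⊗n}) ≤ χ_n`, `exists_stabilizerCover_of_rank_le`), so
`ℂ = ⋃_S {t : ψ_t^{⊗n} ∈ span S}`; the families `S` range over a countable set
(`countable_stabilizerStates`) while `ℂ` is uncountable (`not_countable_complex`), so one
`span S` — one of the linear subspaces making up `Σ_{χ_n}(Stab_n)` — contains infinitely many,
in particular `n + 1` distinct, curve points, hence (`mem_of_perm_invariant_of_line_mem`, the
irreducibility / Vandermonde step) all of `S^n(ℂ²)`. The hypothesis `0 < n` of the printed
statement is not used. [cite: LovitzSteffan2022, Proposition 5.3] -/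
theorem LovitzSteffan2022_prop53_holds : LovitzSteffan2022_prop53 := by
  intro n _hn
  classical
  haveI : Countable (stabilizerStates n) := (countable_stabilizerStates n).to_subtype
  -- every curve point is covered by some family of `χ_n` stabilizer states
  have hcover : ∀ t : ℂ, ∃ S : Fin (genericStabilizerRank n) → stabilizerStates n,
      tensorPow (fun y : QReg 1 => if y 0 then t else 1) n ∈
        Submodule.span ℂ (Set.range fun i => (S i : QReg n → ℂ)) := by
    intro t
    obtain ⟨σ, hσ, hmem⟩ := exists_stabilizerCover_of_rank_le _
      (stabilizerRank_tensorPow_le_genericStabilizerRank (fun y : QReg 1 => if y 0 then t else 1) n)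
    exact ⟨fun i => ⟨σ i, hσ i⟩, hmem⟩
  -- one family covers uncountably (hence infinitely) many curve points
  obtain ⟨S, hS⟩ : ∃ S : Fin (genericStabilizerRank n) → stabilizerStates n,
      ¬ {t : ℂ | tensorPow (fun y : QReg 1 => if y 0 then t else 1) n ∈
        Submodule.span ℂ (Set.range fun i => (S i : QReg n → ℂ))}.Countable := by
    by_contra hall
    push Not at hall
    refine not_countable_complex ((Set.countable_iUnion hall).mono ?_)
    intro t _
    exact Set.mem_iUnion.mpr (hcover t)
  have hinf : {t : ℂ | tensorPow (fun y : QReg 1 => if y 0 then t else 1) n ∈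
      Submodule.span ℂ (Set.range fun i => (S i : QReg n → ℂ))}.Infinite :=
    fun hfin => hS hfin.countable
  -- `n + 1` distinct parameters among them, and the Vandermonde step
  let emb := hinf.natEmbedding
  refine ⟨fun i => (S i : QReg n → ℂ), fun i => (S i).2, fun f hf => ?_⟩
  refine mem_of_perm_invariant_of_line_mem _ (fun i : Fin (n + 1) => (emb i : ℂ)) ?_
    (fun i => (emb i).2) f hf
  intro i i' h
  exact Fin.val_injective (emb.injective (Subtype.val_injective h))

/-! ## Proposition 5.5: `n + 1` cheap distinct angles bound `χ_n` -/

/-! ### Amplitudes by Hamming weight; distinct points of `P¹` -/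

/-- The amplitudes of a symmetric product state depend only on the Hamming weight:
`ψ^{⊗m}(z) = ψ(1)^{|z|} ψ(0)^{m-|z|}` with `|z| = #{i : z_i = 1}` (the coordinates of the
Veronese embedding `ν_m(P¹) ⊆ P(S^m(ℂ²))` in the weight basis of the proof of Proposition 5.4).
[folklore] -/
theorem tensorPow_apply_eq_pow_weight (ψ : QReg 1 → ℂ) (m : ℕ) (z : QReg m) :
    tensorPow ψ m z =
      ψ (fun _ => true) ^ (Finset.univ.filter fun i => z i = true).card *
        ψ (fun _ => false) ^ (m - (Finset.univ.filter fun i => z i = true).card) := by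
  rw [tensorPow_apply]
  have h : ∀ i, ψ (fun _ => z i) =
      if z i = true then ψ (fun _ => true) else ψ (fun _ => false) := by
    intro i
    cases z i <;> simp
  simp_rw [h]
  rw [Finset.prod_ite, Finset.prod_const, Finset.prod_const]
  congr 2
  have := Finset.card_filter_add_card_filter_not
    (s := (Finset.univ : Finset (Fin m))) (fun i => z i = true)
  simp only [Finset.card_univ, Fintype.card_fin] at this
  omega

/-- A one-qubit register label is the constant `0` or the constant `1`. [folklore] -/
theorem qReg_one_eq_const (w : QReg 1) : w = (fun _ => false) ∨ w = (fun _ => true) := by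
  cases h : w 0
  · left
    funext k
    rw [Subsingleton.elim k 0]
    exact h
  · right
    funext k
    rw [Subsingleton.elim k 0]
    exact h

/-- **Distinct points of `P¹` have non-vanishing `2 × 2` determinant**: if `ψ, φ ∈ ℂ²` are
linearly independent then `φ(1)ψ(0) - ψ(1)φ(0) ≠ 0` (the factors of
`Matrix.det_projVandermonde`). [folklore] -/
theorem det_ne_zero_of_linearIndependent_pair {ψ φ : QReg 1 → ℂ}
    (h : LinearIndependent ℂ ![ψ, φ]) :
    φ (fun _ => true) * ψ (fun _ => false) - ψ (fun _ => true) * φ (fun _ => false) ≠ 0 := by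
  intro h0
  rw [LinearIndependent.pair_iff] at h
  have key : ∀ s t : ℂ, s * ψ (fun _ => false) + t * φ (fun _ => false) = 0 →
      s * ψ (fun _ => true) + t * φ (fun _ => true) = 0 → s = 0 ∧ t = 0 := by
    intro s t h1 h2
    refine h s t (funext fun w => ?_)
    rcases qReg_one_eq_const w with rfl | rfl
    · simpa using h1
    · simpa using h2
  by_cases ha : ψ (fun _ => false) = 0 ∧ φ (fun _ => false) = 0
  · by_cases hb : ψ (fun _ => true) = 0 ∧ φ (fun _ => true) = 0
    · exact one_ne_zero (key 1 0 (by rw [ha.1]; ring) (by rw [hb.1]; ring)).1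
    · obtain ⟨h1, h2⟩ := key (φ (fun _ => true)) (-(ψ (fun _ => true)))
        (by linear_combination h0) (by ring)
      exact hb ⟨neg_eq_zero.1 h2, h1⟩
  · obtain ⟨h1, h2⟩ := key (φ (fun _ => false)) (-(ψ (fun _ => false)))
      (by ring) (by linear_combination -h0)
    exact ha ⟨neg_eq_zero.1 h2, h1⟩

/-! ### Any `n + 1` distinct symmetric product states span all of them -/

/-- **"The affine cone over any set of `n+1` distinct states of this form spans `S^n(ℂ²)`"**
(proof of Proposition 5.5), in the form: for `n+1` pairwise linearly independent `ψ_i ∈ ℂ²`,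
EVERY `ψ^{⊗n}` lies in `span{ψ_0^{⊗n}, …, ψ_n^{⊗n}}`. By `tensorPow_apply_eq_pow_weight` this is
the row-span statement for the `(n+1) × (n+1)` projective Vandermonde matrix
`(ψ_i(1)^k ψ_i(0)^{n-k})_{i,k}` (`Matrix.projVandermonde`), whose determinant
`∏_{i<j} (ψ_j(1)ψ_i(0) - ψ_i(1)ψ_j(0))` (`Matrix.det_projVandermonde`) is nonzero for distinct
`[ψ_i] ∈ P¹`; an invertible matrix has surjective `vecMul`. (The general-position version of
`linearIndependent_tensorPow_line`, which treats the affine chart `ψ_t = |0⟩ + t|1⟩`.)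
[cite: LovitzSteffan2022, §5, proof of Proposition 5.5] -/
theorem tensorPow_mem_span_of_pairwise_linearIndependent {n : ℕ}
    (ψs : Fin (n + 1) → QReg 1 → ℂ) (hind : ∀ i j, i ≠ j → LinearIndependent ℂ ![ψs i, ψs j])
    (ψ : QReg 1 → ℂ) :
    tensorPow ψ n ∈ Submodule.span ℂ (Set.range fun i => tensorPow (ψs i) n) := by
  have hdet : (Matrix.projVandermonde (fun i => ψs i (fun _ => true))
      (fun i => ψs i (fun _ => false))).det ≠ 0 := by
    rw [Matrix.det_projVandermonde]
    refine Finset.prod_ne_zero_iff.2 fun i _ => Finset.prod_ne_zero_iff.2 fun j hj => ?_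
    exact det_ne_zero_of_linearIndependent_pair (hind i j (Finset.mem_Ioi.1 hj).ne)
  have hunit : IsUnit (Matrix.projVandermonde (fun i => ψs i (fun _ => true))
      (fun i => ψs i (fun _ => false))) :=
    (Matrix.isUnit_iff_isUnit_det _).2 (isUnit_iff_ne_zero.2 hdet)
  obtain ⟨d, hd⟩ := Matrix.vecMul_surjective_iff_isUnit.2 hunit
    (fun k : Fin (n + 1) => ψ (fun _ => true) ^ (k : ℕ) * ψ (fun _ => false) ^ (n - k))
  rw [Submodule.mem_span_range_iff_exists_fun]
  refine ⟨d, funext fun z => ?_⟩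
  have hk : (Finset.univ.filter fun i => z i = true).card < n + 1 :=
    Nat.lt_succ_of_le (le_trans (Finset.card_filter_le _ _) (by simp))
  have hz := congrFun hd ⟨_, hk⟩
  simp only [Matrix.vecMul, dotProduct, Matrix.projVandermonde_apply, Fin.val_rev,
    Nat.add_sub_add_right] at hz
  rw [Finset.sum_apply]
  simp only [Pi.smul_apply, smul_eq_mul, tensorPow_apply_eq_pow_weight]
  exact hz

/-! ### The discharge of Proposition 5.5 -/

/-- **Discharge of `LovitzSteffan2022_prop55`** (Lovitz–Steffan 2022, Proposition 5.5: "Let `r`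
be a positive integer. If there exists a set of `n+1` distinct qubit states
`{[ψ_1],…,[ψ_{n+1}]} ⊆ P¹` with `χ([ψ_i^{⊗n}]) ≤ r` for all `i ∈ [n+1]`, then `χ_n ≤ r(n+1)`.").
Following the printed proof: the union of optimal stabilizer decompositions of the `ψ_i^{⊗n}`
(`exists_stabilizerDecomposition`, indexed by `Σ i, Fin χ(ψ_i^{⊗n})`) has at most `r(n+1)`
states, and its span contains `span{ψ_i^{⊗n}} ∋ ψ^{⊗n}` for every single-qubit `ψ`
(`tensorPow_mem_span_of_pairwise_linearIndependent`); hence `χ(ψ^{⊗n}) ≤ r(n+1)`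
(`stabilizerRank_le_card`) for every `ψ`, i.e. for the supremum `χ_n`. The hypotheses `0 < n`,
`0 < r` of the printed statement are not used. [cite: LovitzSteffan2022, Proposition 5.5] -/
theorem LovitzSteffan2022_prop55_holds : LovitzSteffan2022_prop55 := by
  intro n r _hn _hr ψs hind hrank
  unfold genericStabilizerRank
  refine csSup_le' ?_
  rintro _ ⟨ψ, rfl⟩
  show stabilizerRank (tensorPow ψ n) ≤ r * (n + 1)
  -- optimal decompositions of the `n+1` cheap states
  choose c φ hφ hdec using fun i => exists_stabilizerDecomposition (tensorPow (ψs i) n)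
  -- `ψ^{⊗n}` lies in the span of the union of all states appearing in them
  have hmem : tensorPow ψ n ∈ Submodule.span ℂ (Set.range
      fun p : (Σ i : Fin (n + 1), Fin (stabilizerRank (tensorPow (ψs i) n))) => φ p.1 p.2) := by
    refine (Submodule.span_le.2 ?_) (tensorPow_mem_span_of_pairwise_linearIndependent ψs hind ψ)
    rintro _ ⟨i, rfl⟩
    show tensorPow (ψs i) n ∈ _
    rw [hdec i]
    exact Submodule.sum_mem _ fun j _ =>
      Submodule.smul_mem _ _ (Submodule.subset_span ⟨⟨i, j⟩, rfl⟩)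
  obtain ⟨e, he⟩ := (Submodule.mem_span_range_iff_exists_fun ℂ).1 hmem
  calc stabilizerRank (tensorPow ψ n)
      ≤ Fintype.card (Σ i : Fin (n + 1), Fin (stabilizerRank (tensorPow (ψs i) n))) :=
        stabilizerRank_le_card e (fun p => φ p.1 p.2) (fun p => hφ p.1 p.2) he.symm
    _ = ∑ i, stabilizerRank (tensorPow (ψs i) n) := by simp [Fintype.card_sigma]
    _ ≤ ∑ _i : Fin (n + 1), r := Finset.sum_le_sum fun i _ => hrank i
    _ = r * (n + 1) := by simp [mul_comm]

end Literature.Computability.QuantumComplexity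

end
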